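import Summits.AtomisticToContinuum.BoseEinsteinCondensation.Theorems.BECInsertionCorrectorCorrectorClosureDoublingLeInvResidue
import Summits.AtomisticToContinuum.BoseEinsteinCondensation.Theorems.BECInsertionCorrectorCorrectorClosureFlatDomination
import Literature.MathematicalPhysics.QuantumManyBody.PeriodicHeatFlowSpectralProofs
import HarnessLib

/-!
# The Laplace (imaginary-time) energy bound of the removal state (line `residue-area-law`,
# stub `stub_removalLaplace`)

Crux `BECInsertionCorrector.CorrectorClosure` (item stmt-AtomisticToContinuum-12058), line
`residue-area-law`, stub `stub_removalLaplace` (first brick of the removal factor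
`stub_removalFidelity`).

Fix `N`, a box `L > 0` and a measurable pair potential `v ≥ 0`. Let `Φ₀ : Config (N + 1) → ℝ` be
the continuous positive `(N+1)`-body torus Feynman–Kac ground state (`IsPeriodicGroundStateFK`)
and `G(X) = ∫_cell Φ₀(x, X) dx` its zero-mode REMOVAL amplitude (particle `0` integrated out over
the cell). We prove, for every `t ≥ 0`,
`e^{-tE₀(N+1)} (∫_{cell^N} G²)² ≤ L³ ∫_{cell^N} G · (e^{-tH_N} G)`, the semigroup read through
`periodicFKSemigroup v L t`.

Proof. Put the removal amplitude back flat, `ψ₀ = G ∘ vecTail` on `Config (N + 1)` (bounded,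
measurable, periodic, `≥ 0`), and let `V(t) = ∫_{cell^{N+1}} ψ₀ · e^{-tH_{N+1}} ψ₀`.
* GROUND-STATE COMPONENT, in the real Hilbert space `L²(cellN (N+1) L)` with
  `T_t = pfkL2 v L t`, `ψ = [ψ₀]`, `e = [Φ₀]` (unit eigenvector of the symmetric positive `T_t`
  with eigenvalue `e^{-tE₀}`, `pfkL2_toLp_groundState`): the two-level splitting
  `ψ = ⟪e,ψ⟫e + ψ^⊥` gives `e^{-tE₀}⟪e,ψ⟫² ≤ ⟪T_t ψ, ψ⟫ = V(t)` (`dli_mul_inner_sq_le_inner`); at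
  `t = 0` this is Cauchy–Schwarz `⟪e,ψ⟫² ≤ ‖ψ‖² = V(0)`. The overlap is
  `⟪e, ψ⟫ = ∫_{cell^{N+1}} Φ₀ · G∘vecTail = ∫_{cell^N} G(X) ∫_cell Φ₀(x, X) dx dX = ∫ G²`
  (`fid_overlap_eq`, tagged coordinate innermost).
* DOMINATION: along every sample the `(N+1)`-body action dominates the bath action of the tail
  world-lines and `ψ₀` depends on the sample only through the tails, so
  `(e^{-tH_{N+1}}ψ₀)(X) ≤ (e^{-tH_N}G)(vecTail X)` (`flatDom_periodicFKSemigroup_tail_le`), whence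
  `V(t) ≤ ∫_{cell × cell^N} G(Y) (e^{-tH_N}G)(Y) dx dY = L³ ∫_{cell^N} G · e^{-tH_N}G` (Tonelli
  with the inserted coordinate outermost).
No Perron–Frobenius / boundedness of `v^per` is needed: only symmetry, positivity and the
eigen-relation of the semigroup enter.
-/

noncomputable section

open MeasureTheory Filter Matrix
open scoped ENNReal NNReal BigOperators ComplexConjugate InnerProductSpace

namespace Summit.AtomisticToContinuum.BoseEinsteinCondensation.Theorems.CorrectorClosure.ResidueAreaLaw

open Literature.MathematicalPhysics.QuantumManyBody.BoseGas
open Summit.AtomisticToContinuum.BoseEinsteinCondensation.Theorems.CorrectorClosure.HealingScaleKacInsertion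

variable {N : ℕ}

/-! ### The removal amplitude `G(X) = ∫_cell Φ₀(x, X) dx` -/

/-- Moving bath particle `j` of `(x, Y)` is moving particle `j + 1`:
`(x, Y + e_j ⊗ u) = (x, Y) + e_{j+1} ⊗ u`. [folklore] -/
theorem rl_vecCons_add_single (x : Space) (Y : Config N) (j : Fin N) (u : Space) :
    (vecCons x (Y + Pi.single j u) : Config (N + 1)) = vecCons x Y + Pi.single j.succ u := by
  funext i
  refine Fin.cases ?_ (fun m => ?_) i
  · simp [Ne.symm (Fin.succ_ne_zero j)]
  · by_cases h : m = j
    · subst h; simp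
    · simp [h, Fin.succ_inj]

/-- The removal amplitude `X ↦ ∫_cell Φ₀(x, X) dx` of a continuous `Φ₀` is measurable. [folklore] -/
theorem rl_measurable_removal {L : ℝ} {Φ₀ : Config (N + 1) → ℝ} (hΦc : Continuous Φ₀) :
    Measurable fun X : Config N => ∫ x in cell L, Φ₀ (vecCons x X) := by
  have hsm : StronglyMeasurable
      (Function.uncurry fun (X : Config N) (x : Space) => Φ₀ (vecCons x X)) :=
    (hΦc.comp (continuous_snd.matrixVecCons continuous_fst)).measurable.stronglyMeasurable
  exact (hsm.integral_prod_right (ν := volume.restrict (cell L))).measurable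

/-- The removal amplitude of a bounded `Φ₀` is bounded: `|∫_cell Φ₀(x, X) dx| ≤ M' · |cell|`.
[folklore] -/
theorem rl_abs_removal_le {L : ℝ} {Φ₀ : Config (N + 1) → ℝ} {M' : ℝ} (hM' : ∀ X, |Φ₀ X| ≤ M')
    (X : Config N) : |∫ x in cell L, Φ₀ (vecCons x X)| ≤ M' * volume.real (cell L) := by
  have hvol : volume (cell L) ≠ ⊤ := by
    rw [volume_cell]; exact ENNReal.pow_ne_top ENNReal.ofReal_ne_top
  rw [← Real.norm_eq_abs]
  exact norm_setIntegral_le_of_norm_le_const hvol.lt_top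
    fun x _ => by rw [Real.norm_eq_abs]; exact hM' (vecCons x X)

/-- The removal amplitude of a periodic `Φ₀` is periodic in every bath particle. [folklore] -/
theorem rl_removal_periodic {L : ℝ} {Φ₀ : Config (N + 1) → ℝ}
    (hper : ∀ (X : Config (N + 1)) (i : Fin (N + 1)) (k : Fin 3),
      Φ₀ (X + Pi.single i (EuclideanSpace.single k L)) = Φ₀ X)
    (X : Config N) (i : Fin N) (k : Fin 3) :
    ∫ x in cell L, Φ₀ (vecCons x (X + Pi.single i (EuclideanSpace.single k L))) =
      ∫ x in cell L, Φ₀ (vecCons x X) := by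
  simp only [rl_vecCons_add_single, hper]

/-! ### The flat datum `G ∘ vecTail` of a bounded periodic `G ≥ 0` -/

/-- The functional of the flat datum of a bounded `G` is bounded by the same constant (sub-Markov
property). [folklore] -/
theorem rl_semigroup_tail_le (v : ℝ → ℝ≥0∞) (L s : ℝ) {G : Config N → ℝ} {B : ℝ}
    (hGB : ∀ X, |G X| ≤ B) (X : Config (N + 1)) :
    periodicFKSemigroup v L s (fun Y => ENNReal.ofReal (G (vecTail Y))) X ≤ ENNReal.ofReal B :=
  (periodicFKSemigroup_le_iSup v L s _ X).trans
    (iSup_le fun Y => ENNReal.ofReal_le_ofReal ((le_abs_self _).trans (hGB (vecTail Y))))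

/-- **The flat pairing is a diagonal matrix element of `e^{-sH}` on `L²(cell)`**: for `s > 0`,
`V(s) = ⟪e^{-sH}[ψ₀], [ψ₀]⟫` read in `ℝ`, `[ψ₀]` the `L²(cell)` class of the flat datum
`ψ₀ = G ∘ vecTail` of a bounded measurable periodic `G ≥ 0` (`inner_pfkL2_toLp`, then
Bochner = lower integral for the nonnegative integrand). [folklore] -/
theorem rl_toReal_eq_inner {v : ℝ → ℝ≥0∞} (hv : Measurable v) {L : ℝ} (hL : 0 < L)
    {G : Config N → ℝ} (hGm : Measurable G) (hG0 : ∀ X, 0 ≤ G X) {B : ℝ} (hGB : ∀ X, |G X| ≤ B)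
    (hper : ∀ (X : Config N) (i : Fin N) (k : Fin 3),
      G (X + Pi.single i (EuclideanSpace.single k L)) = G X)
    (h2 : MemLp (fun X : Config (N + 1) => G (vecTail X)) 2 (volume.restrict (cellN (N + 1) L)))
    {s : ℝ} (hs : 0 < s) :
    (∫⁻ X in cellN (N + 1) L, ENNReal.ofReal (G (vecTail X)) *
        periodicFKSemigroup v L s (fun Y => ENNReal.ofReal (G (vecTail Y))) X).toReal =
      ⟪pfkL2 v L s (h2.toLp _), h2.toLp _⟫_ℝ := by
  have hgm : Measurable fun X : Config (N + 1) => G (vecTail X) := hGm.comp measurable_vecTail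
  have hg0 : ∀ X : Config (N + 1), 0 ≤ G (vecTail X) := fun X => hG0 _
  have hper' : ∀ (X : Config (N + 1)) (i : Fin (N + 1)) (k : Fin 3),
      G (vecTail (X + Pi.single i (EuclideanSpace.single k L))) = G (vecTail X) :=
    fun X i k => dli_tail_periodic hper X i k
  have hint : ∫ X in cellN (N + 1) L, G (vecTail X) * pfkReal v L s (fun Y => G (vecTail Y)) X =
      (∫⁻ X in cellN (N + 1) L, ENNReal.ofReal (G (vecTail X)) *
        periodicFKSemigroup v L s (fun Y => ENNReal.ofReal (G (vecTail Y))) X).toReal := by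
    rw [integral_eq_lintegral_of_nonneg_ae
        (Eventually.of_forall fun X => mul_nonneg (hg0 X) (pfkReal_nonneg v L s hg0 X))
        (hgm.mul (measurable_pfkReal hv L s hgm)).aestronglyMeasurable]
    congr 1
    refine lintegral_congr fun X => ?_
    rw [ENNReal.ofReal_mul (hg0 X), pfkReal_eq_toReal_periodicFKSemigroup hv L s hgm hg0 X,
      ENNReal.ofReal_toReal
        (ne_top_of_le_ne_top ENNReal.ofReal_ne_top (rl_semigroup_tail_le v L s hGB X))]
  rw [inner_pfkL2_toLp hv hL hs h2 h2 hper', hint]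

/-- **Flat domination of the pairing, with the cell factor**: for a measurable `G ≥ 0` (read in
`[0, ∞]` as `g = ofReal ∘ G`) and every `t`,
`∫_{cell^{N+1}} g(tail X) (e^{-tH_{N+1}} g∘tail)(X) ≤ L³ ∫_{cell^N} g · e^{-tH_N} g`
(`flatDom_periodicFKSemigroup_tail_le`, then Tonelli with the inserted coordinate outermost).
[folklore] -/
theorem rl_pairing_tail_le {v : ℝ → ℝ≥0∞} (hv : Measurable v) {L : ℝ} (hL : 0 < L) (t : ℝ)
    {g : Config N → ℝ≥0∞} (hg : Measurable g) :
    ∫⁻ X in cellN (N + 1) L, g (vecTail X) * periodicFKSemigroup v L t (fun Y => g (vecTail Y)) X ≤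
      ENNReal.ofReal (L ^ 3) * ∫⁻ Y in cellN N L, g Y * periodicFKSemigroup v L t g Y := by
  have hmeas : Measurable fun X : Config (N + 1) =>
      g (vecTail X) * periodicFKSemigroup v L t g (vecTail X) :=
    (hg.comp measurable_vecTail).mul ((measurable_periodicFKSemigroup hv L t hg).comp measurable_vecTail)
  calc ∫⁻ X in cellN (N + 1) L, g (vecTail X) * periodicFKSemigroup v L t (fun Y => g (vecTail Y)) X
      ≤ ∫⁻ X in cellN (N + 1) L, g (vecTail X) * periodicFKSemigroup v L t g (vecTail X) :=
        lintegral_mono fun X => mul_le_mul' le_rfl (flatDom_periodicFKSemigroup_tail_le hv L t hg X)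
    _ = ENNReal.ofReal (L ^ 3) * ∫⁻ Y in cellN N L, g Y * periodicFKSemigroup v L t g Y := by
        rw [setLIntegral_cellN_succ_left hmeas]
        simp only [Matrix.tail_cons]
        rw [setLIntegral_const, volume_cell, ← ENNReal.ofReal_pow hL.le, mul_comm]

/-! ### The stub -/

set_option linter.unusedVariables false in
/-- **Stub `stub_removalLaplace` of line `residue-area-law` — the Laplace (imaginary-time) energy
bound of the removal state.** In a box `L > 0`, let `Φ₀` be the continuous positive torus FK ground
state of `N + 1` bodies and `G(X) = ∫_cell Φ₀(x, X) dx` its zero-mode removal amplitude. Then for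
every `t ≥ 0`: `e^{-tE₀(N+1)} (∫_{cell^N} G²)² ≤ L³ ∫_{cell^N} G · (e^{-tH_N} G)`, the semigroup
read through `periodicFKSemigroup v L t`. Proof: with `ψ₀ = G ∘ vecTail` and
`V(t) = ∫_{cell^{N+1}} ψ₀ · e^{-tH_{N+1}}ψ₀`, (ii) in `L²(cellN (N+1) L)` the class `[Φ₀]` is a unit
eigenvector (eigenvalue `e^{-tE₀}`) of the symmetric positive `pfkL2 v L t`, so the two-level
splitting gives `e^{-tE₀}⟪[Φ₀],[ψ₀]⟫² ≤ V(t)` (Cauchy–Schwarz at `t = 0`), and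
`⟪[Φ₀],[ψ₀]⟫ = ∫_{cell^N} G ∫_cell Φ₀ = ∫ G²` (`fid_overlap_eq`); (i) flat domination
`(e^{-tH_{N+1}}ψ₀)(X) ≤ (e^{-tH_N}G)(vecTail X)` and Tonelli give `V(t) ≤ L³ ∫ G · e^{-tH_N}G`.
The hypotheses `hb` (bounded `v^per`) and `hΦp` (`Φ₀ > 0`) are part of the registered signature
but not used by this proof. [cite: GlimmJaffeQP1987, §3.3 Thm 3.3.2] -/
theorem stub_removalLaplace (v : ℝ → ℝ≥0∞) (hv : Measurable v) (N : ℕ) (L : ℝ) (hL : 0 < L)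
    (hb : ∃ C : ℝ≥0, ∀ x, periodizedPotential v L x ≤ C)
    (Φ₀ : Config (N + 1) → ℝ) (hΦ : IsPeriodicGroundStateFK v L Φ₀) (hΦc : Continuous Φ₀)
    (hΦp : ∀ X, 0 < Φ₀ X)
    (G : Config N → ℝ) (hG : G = fun X => ∫ x in cell L, Φ₀ (vecCons x X)) (t : ℝ) (ht : 0 ≤ t) :
    ENNReal.ofReal (Real.exp (-((periodicGroundStateEnergy v (N + 1) L).toReal * t))) *
        (∫⁻ X in cellN N L, ENNReal.ofReal (G X) ^ 2) ^ 2 ≤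
      ENNReal.ofReal (L ^ 3) *
        ∫⁻ X in cellN N L, ENNReal.ofReal (G X) *
          periodicFKSemigroup v L t (fun Y => ENNReal.ofReal (G Y)) X := by
  -- Step 0: the removal amplitude is measurable, nonnegative, bounded and periodic
  obtain ⟨M', -, hM'⟩ := exists_bound_of_continuous_periodic hL hΦc hΦ.periodic
  have hGX : ∀ X, ∫ x in cell L, Φ₀ (vecCons x X) = G X := fun X => by rw [hG]
  have hGm : Measurable G := by rw [hG]; exact rl_measurable_removal hΦc
  have hG0 : ∀ X, 0 ≤ G X := fun X => by
    rw [← hGX]; exact setIntegral_nonneg (measurableSet_cell L) fun x _ => hΦ.nonneg _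
  have hGB : ∀ X, |G X| ≤ M' * volume.real (cell L) := fun X => by
    rw [← hGX]; exact rl_abs_removal_le hM' X
  have hGper : ∀ (X : Config N) (i : Fin N) (k : Fin 3),
      G (X + Pi.single i (EuclideanSpace.single k L)) = G X := fun X i k => by
    rw [← hGX, ← hGX]; exact rl_removal_periodic hΦ.periodic X i k
  have hGm' : Measurable fun Y : Config N => ENNReal.ofReal (G Y) :=
    ENNReal.measurable_ofReal.comp hGm
  -- Step 1: the Hilbert-space objects `ψ = [G ∘ vecTail]`, `e = [Φ₀]`, the overlap `I = ∫ G²`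
  have h2 : MemLp (fun X : Config (N + 1) => G (vecTail X)) 2
      (volume.restrict (cellN (N + 1) L)) :=
    memLp_two_cellN_of_bound L (hGm.comp measurable_vecTail) fun X => hGB (vecTail X)
  have hΦ2 : MemLp Φ₀ 2 (volume.restrict (cellN (N + 1) L)) :=
    memLp_two_cellN_of_continuous_periodic hL hΦc hΦ.periodic
  set ψ : Lp ℝ 2 (volume.restrict (cellN (N + 1) L)) := h2.toLp fun X => G (vecTail X)
  set e : Lp ℝ 2 (volume.restrict (cellN (N + 1) L)) := hΦ2.toLp Φ₀
  set I : ℝ := ∫ X in cellN N L, G X * G X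
  have hI0 : 0 ≤ I :=
    setIntegral_nonneg (measurableSet_cellN N L) fun X _ => mul_nonneg (hG0 X) (hG0 X)
  have he1 : ‖e‖ = 1 := norm_toLp_groundState hΦ hΦ2
  -- `∫⁻ ofReal G ^ 2 = ofReal I`
  have hIlint : ∫⁻ X in cellN N L, ENNReal.ofReal (G X) ^ 2 = ENNReal.ofReal I := by
    have hB0 : 0 ≤ M' * volume.real (cell L) := (abs_nonneg _).trans (hGB 0)
    have hint : Integrable (fun X => G X * G X) (volume.restrict (cellN N L)) :=
      integrable_cellN_of_bound L (hGm.mul hGm) fun X => by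
        rw [abs_mul]; exact mul_le_mul (hGB X) (hGB X) (abs_nonneg _) hB0
    rw [ofReal_integral_eq_lintegral_ofReal hint
      (Eventually.of_forall fun X => mul_nonneg (hG0 X) (hG0 X))]
    exact lintegral_congr fun X => by rw [sq, ENNReal.ofReal_mul (hG0 X)]
  -- the overlap `⟪e, ψ⟫ = ∫_{cell^{N+1}} Φ₀ · G∘vecTail = ∫ G ∫_cell Φ₀ = I`
  have hov : ∫⁻ Y in cellN (N + 1) L, ENNReal.ofReal (Φ₀ Y) * ENNReal.ofReal (G (vecTail Y)) =
      ENNReal.ofReal I := by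
    rw [fid_overlap_eq hGm hG0 hGB hΦc hΦ.nonneg hM']
    simp only [hGX]
    rfl
  have heψ : ⟪e, ψ⟫_ℝ = I := by
    have ha0 : 0 ≤ ∫ X in cellN (N + 1) L, Φ₀ X * G (vecTail X) :=
      setIntegral_nonneg (measurableSet_cellN (N + 1) L) fun X _ =>
        mul_nonneg (hΦ.nonneg X) (hG0 _)
    have hprod : Integrable (fun X => Φ₀ X * G (vecTail X)) (volume.restrict (cellN (N + 1) L)) :=
      hΦ2.integrable_mul h2
    rw [inner_toLp_cellN hΦ2 h2, ← ENNReal.ofReal_eq_ofReal_iff ha0 hI0, ← hov,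
      ofReal_integral_eq_lintegral_ofReal hprod
        (Eventually.of_forall fun X => mul_nonneg (hΦ.nonneg X) (hG0 _))]
    exact lintegral_congr fun X => ENNReal.ofReal_mul (hΦ.nonneg X)
  -- Step 2: the flat pairing `V = ∫ ψ₀ · e^{-tH}ψ₀` is finite
  set V : ℝ≥0∞ := ∫⁻ X in cellN (N + 1) L, ENNReal.ofReal (G (vecTail X)) *
      periodicFKSemigroup v L t (fun Y => ENNReal.ofReal (G (vecTail Y))) X with hV
  have hVtop : V ≠ ⊤ := by
    refine ne_top_of_le_ne_top ?_ (lintegral_mono fun X => mul_le_mul'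
      (ENNReal.ofReal_le_ofReal ((le_abs_self _).trans (hGB (vecTail X))))
      (rl_semigroup_tail_le v L t hGB X))
    rw [setLIntegral_const]
    exact ENNReal.mul_ne_top (ENNReal.mul_ne_top ENNReal.ofReal_ne_top ENNReal.ofReal_ne_top)
      (volume_cellN_ne_top _ _)
  -- Step 3: the ground-state component `e^{-tE₀} I² ≤ V`
  have hkey : Real.exp (-((periodicGroundStateEnergy v (N + 1) L).toReal * t)) * I ^ 2 ≤
      V.toReal := by
    rcases ht.eq_or_lt with h0 | ht'
    · -- `t = 0`: Cauchy–Schwarz `⟪e, ψ⟫² ≤ ‖ψ‖² = V(0)`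
      have hV0 : V = ∫⁻ X in cellN (N + 1) L, ENNReal.ofReal (G (vecTail X) ^ 2) := by
        rw [hV, ← h0]
        simp only [periodicFKSemigroup_of_nonpos v L le_rfl]
        exact lintegral_congr fun X => by rw [sq, ENNReal.ofReal_mul (hG0 _)]
      have hψV : ‖ψ‖ ^ 2 = V.toReal := by
        rw [hV0, ← ofReal_norm_toLp_sq h2, ENNReal.toReal_ofReal (sq_nonneg _)]
      rw [← h0, mul_zero, neg_zero, Real.exp_zero, one_mul, ← hψV, ← heψ]
      have h := abs_real_inner_le_norm e ψ
      rw [he1, one_mul] at h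
      have h' := pow_le_pow_left₀ (abs_nonneg _) h 2
      rwa [sq_abs] at h'
    · -- `t > 0`: two-level splitting for the symmetric positive `T_t` with `T_t e = e^{-tE₀} e`
      have hsym : ∀ x y : Lp ℝ 2 (volume.restrict (cellN (N + 1) L)),
          ⟪pfkL2 v L t x, y⟫_ℝ = ⟪x, pfkL2 v L t y⟫_ℝ := fun x y => inner_pfkL2_comm hv hL ht' x y
      have hpos : ∀ x : Lp ℝ 2 (volume.restrict (cellN (N + 1) L)), 0 ≤ ⟪pfkL2 v L t x, x⟫_ℝ :=
        fun x => inner_pfkL2_self_nonneg hv hL ht' x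
      have hTe : pfkL2 v L t e =
          Real.exp (-((periodicGroundStateEnergy v (N + 1) L).toReal * t)) • e :=
        pfkL2_toLp_groundState hv hL ht' hΦ hΦ2
      rw [hV, rl_toReal_eq_inner hv hL hGm hG0 hGB hGper h2 ht', ← heψ]
      exact dli_mul_inner_sq_le_inner _ hsym hpos he1 hTe ψ
  -- Step 4: assemble with flat domination
  calc ENNReal.ofReal (Real.exp (-((periodicGroundStateEnergy v (N + 1) L).toReal * t))) *
        (∫⁻ X in cellN N L, ENNReal.ofReal (G X) ^ 2) ^ 2
      = ENNReal.ofReal (Real.exp (-((periodicGroundStateEnergy v (N + 1) L).toReal * t)) *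
          I ^ 2) := by
        rw [hIlint, ← ENNReal.ofReal_pow hI0, ← ENNReal.ofReal_mul (Real.exp_nonneg _)]
    _ ≤ ENNReal.ofReal V.toReal := ENNReal.ofReal_le_ofReal hkey
    _ = V := ENNReal.ofReal_toReal hVtop
    _ ≤ ENNReal.ofReal (L ^ 3) * ∫⁻ X in cellN N L, ENNReal.ofReal (G X) *
          periodicFKSemigroup v L t (fun Y => ENNReal.ofReal (G Y)) X :=
        rl_pairing_tail_le hv hL t hGm'

end Summit.AtomisticToContinuum.BoseEinsteinCondensation.Theorems.CorrectorClosure.ResidueAreaLaw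

end
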